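import Summits.BirchSwinnertonDyer.BirchSwinnertonDyer.Theorems.KatoDescentTamePotSupersingularTameUpperUnitTwistRecordRoads
import Summits.BirchSwinnertonDyer.BirchSwinnertonDyer.Theorems.KatoDescentTamePotSupersingularJetchevIrreducibleReadingTwoSplit
import HarnessLib

/-!
# Route `KatoDescentTamePotSupersingular` (rung K8, sub-rung B4 (t′), cell `bsd-potss`): the ♯ UNIT-TWIST road in RECORD-INPUT form
# over the FOUR NAMED FACTS (seat `bsd-potss-k8t-c4` g14; route-free; a certificate shape — nothing booked, no item closed, BSD is
# not proved by any of this)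

WHY. `TameUpperUnitTwistRecords.missingUpperBoundAt_sharp_of_datum_of_unitTwist` (p597083, over this seat's p573646) takes the
two-split Jetchev reading as a displayed SCHEMA `hJ2` (a 20-line binder). k9-c4 g11's
`JetchevIrreducibleSwapAtP.cor15_irreducibleReadingTwoSplit_of_namedFacts` (p564108) PROVES that schema from four named Literature
facts — Matar–Nekovář 2019 Thm 0.7 (`hS1`), Gross 1991 Prop 3.7 (2) (`h37`), Poitou–Tate for Selmer structures (`hPT`), Gross–Zagier
III (3.1) image-free (`hF1`) — plus Kolyvagin (`hKo`) and modularity as newforms (`hnf`). This file substitutes that proof, so a ♯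
record displays six SHORT named-fact binders (by name, exactly the held aliases 23034–23037 of the KT route + two published inputs)
instead of the schema: `missingUpperBoundAt_sharp_of_namedFacts_of_datum_of_unitTwist`.

HONEST FRAMING: CONDITIONAL on every displayed hypothesis (the four named facts are cite-level, HELD items 23034–23037; Gross–Zagier,
Kolyvagin, Matar–Nekovář 0.3, GZK, modularity are published inputs); the twist's analytic rank and `#Ш_an` are NUMERICAL data
displayed by the records; per-ROW statement (never a ∀-item); closes nothing; 0 definitions, 0 named facts minted, 0 `sorry`.

References: [Jetchev2008] Thm. 1.4, Cor. 1.5, Rem. 6.2; [MatarNekovar2019] Thm. 0.3, Thm. 0.7, §0.11; [GrossLMS1991] Prop. 3.7 (2);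
[GrossZagier1986] I.6.3, III (3.1); [MilneADT2006] I Thm. 4.10; [KolyvaginEulerSystems1990] Thm. A; [Miller2011LMS] Def. 1.1.
-/

set_option autoImplicit false
-- the Theorems directory repeats the summit name (sibling precedent `KatoDescentPotSupersingularAssembly.lean`)
set_option linter.dupNamespace false

noncomputable section

open scoped Classical NumberField

namespace Summit.BirchSwinnertonDyer.BirchSwinnertonDyer.Theorems.TameUpperUnitTwistRecords

open WeierstrassCurve NumberField Literature.NumberTheory.EllipticCurves
  Literature.NumberTheory.EllipticCurves.ModularForms
  Literature.NumberTheory.EllipticCurves.Rank1Residual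
  Literature.NumberTheory.EllipticCurves.Rank1Residual.Typed
  Literature.NumberTheory.GaloisCohomology
  Summit.BirchSwinnertonDyer.Rank1Residual
  Summit.BirchSwinnertonDyer.Rank1Residual.Additive
  Summit.BirchSwinnertonDyer.BirchSwinnertonDyer.Theorems

/-- **♯ UNIT-TWIST ROAD, record-input form, over the FOUR NAMED FACTS.** As
`missingUpperBoundAt_sharp_of_datum_of_unitTwist` (p597083), with the schema `hJ2` (two-split Jetchev reading) DERIVED from
Matar–Nekovář 2019 Thm 0.7 (`hS1`), Gross 1991 Prop 3.7 (2) (`h37`), Poitou–Tate for Selmer structures (`hPT`), Gross–Zagier III (3.1)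
image-free (`hF1`), Kolyvagin (`hKo`) and modularity as newforms (`hnf`) by k9-c4 g11's
`JetchevIrreducibleSwapAtP.cor15_irreducibleReadingTwoSplit_of_namedFacts`. Row inputs: conductor `N` (`hN`), `r_an(W) = 0`,
`Addv W p`, `ord_p j ≥ 0`, non-CM, `W[p]` irreducible with `p`-adic tower NOT onto, `p ∤ c_p(W)`, a lattice-OPTIMAL datum `D` of level
`N` with `p ∤ c(D)`, the single Tamagawa carrier (`hsingle`), the Heegner field (`hK`, `hHN`, `d_K ≡ 1 (8)`, `d_K < −4`), the minimal
twist model with `Cd • W^{(d_K)} = Wd`, and the displayed numerics `r_an(Wd) = 1`, `#Ш_an(Wd) = qd`, `ord_p qd ≤ 0`. CONDITIONAL on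
the displayed hypotheses; per row; closes nothing. [cite: Jetchev2008, Thm. 1.4, Cor. 1.5 (p. 3), Rem. 6.2]
[cite: MatarNekovar2019, Thm. 0.3 (p. 456), Thm. 0.7] [cite: GrossLMS1991, Prop. 3.7 (2)] [cite: GrossZagier1986, Thm. I.6.3, III (3.1)]
[cite: MilneADT2006, I Thm. 4.10] [cite: Miller2011LMS, Def. 1.1] -/
theorem missingUpperBoundAt_sharp_of_namedFacts_of_datum_of_unitTwist
    (hGZ : ∀ (N : ℕ) [NeZero N] (W : WeierstrassCurve ℚ) (K : Type) [Field K] [NumberField K],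
      gross_zagier N W K)
    (hKo : ∀ (N : ℕ) [NeZero N] (W : WeierstrassCurve ℚ) (K : Type) [Field K] [NumberField K],
      kolyvagin N W K)
    (hMN : ∀ (N : ℕ) [NeZero N] (W : WeierstrassCurve ℚ) (K : Type) [Field K] [NumberField K],
      MatarNekovar2019.thm03_padicValNat_card_sha_le_of_irreducible N W K)
    (hGZK : rank_eq_analyticRank_of_analyticRank_le_one) (hmod : hasEntireLFunction_rat)
    (hS1 : MatarNekovar2019.thm07_padicValNat_card_sha_primary_add_le_of_globalDivisibility_of_irreducible)
    (h37 : GrossLMS1991.prop37_2_frobeniusCongruence)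
    (hPT : ∀ (K : Type) [Field K] [NumberField K], poitouTate_selmerStructure_duality_conj K)
    (hF1 : Gross1991_heegnerPoint_sub_ratTorsion_mem_E0_imageFree) (hnf : exists_isNewformOf)
    (W : WeierstrassCurve ℚ) [W.IsElliptic] [W.IsGloballyMinimal] (p : ℕ) [Fact p.Prime] (hp2 : p ≠ 2)
    {N : ℕ} [NeZero N] (hN : W.conductorNorm ℤ = N)
    (hr : W.analyticRank = 0) (hadd : Addv W p) (hj : 0 ≤ padicValRat p W.j) (hcm : ¬ W.HasCM)
    (hirr : W.HasIrreducibleModPGaloisRep p) (hns : ¬ (∀ n : ℕ, W.HasSurjectiveModNGaloisRep (p ^ n : ℕ)))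
    (hcp : ¬ p ∣ (W.baseChange ℚ_[p]).localTamagawaNumber ℤ_[p])
    (D : ModularParametrizationData W N)
    (hopt : ∀ z ∈ D.L.lattice, ∃ w ∈ periodLattice D.f, z = (D.c : ℂ) * w) (hc : ¬ (p : ℤ) ∣ D.c)
    (hsingle : p ∣ W.tamagawaProduct → ∃ (q : ℕ) (_ : Fact q.Prime), q ∣ N ∧ ¬ q ^ 2 ∣ N ∧ q ≠ p ∧
      padicValNat p W.tamagawaProduct ≤ padicValNat p ((W.baseChange ℚ_[q]).localTamagawaNumber ℤ_[q]))
    (K : Type) [Field K] [NumberField K] (hK : IsImaginaryQuadratic K) (hHN : SatisfiesHeegnerHypothesis N K)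
    (h8 : NumberField.discr K % 8 = 1) (hd4 : NumberField.discr K < -4)
    (Wd : WeierstrassCurve ℚ) [Wd.IsElliptic] [Wd.IsGloballyMinimal] (Cd : VariableChange ℚ)
    (hWd : Cd • W.quadraticTwist (NumberField.discr K : ℚ) = Wd) (hrd : Wd.analyticRank = 1)
    {qd : ℚ} (hqd : shaAn Wd = (qd : ℂ)) (hvd : padicValRat p qd ≤ 0) :
    MissingUpperBoundAt W p :=
  missingUpperBoundAt_sharp_of_datum_of_unitTwist hGZ hKo hMN hGZK hmod
    (JetchevIrreducibleSwapAtP.cor15_irreducibleReadingTwoSplit_of_namedFacts hS1 h37 hPT hF1 hKo hnf) W p hp2 hN hr hadd hj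
    hcm hirr hns hcp D hopt hc hsingle K hK hHN h8 hd4 Wd Cd hWd hrd hqd hvd

end Summit.BirchSwinnertonDyer.BirchSwinnertonDyer.Theorems.TameUpperUnitTwistRecords
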